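import Mathlib
import Literature.Geometry.DiscreteGeometry.TwoShellChartSemantics
import Summits.AtomisticToContinuum.Crystallization.Theorems.NashClassCertificatesNashNearFieldStubLabelledPlacementLabels

/-!
# Crux `NashClassCertificates.NashNearField` (stmt-AtomisticToContinuum-16827), line `birth`,
# stub `stub_labelledPlacement` — soundness IVa: SYMMETRY of witnesses and ORBIT representatives

A pivot witness composed with a symmetry of its pattern (`symList`: signed permutations for fcc, permutations for hcp)
is again a good witness (`pivotGood_symm`), and its labels are the pre-images of the old ones (`labelsOK_symm`); through
the orbit certificate (`checkOrbits`, soundness `rep_of_checkOrbits`) the actual labelling of every pivot may therefore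
be taken to be one of the listed REPRESENTATIVES (`exists_rep_witness`).  Also: soundness of the checker's list
permutation test `ivPerm`.
-/

noncomputable section

open Literature.Geometry.DiscreteGeometry Literature.Geometry.DiscreteGeometry.TwoShellCheck
  Literature.Geometry.DiscreteGeometry.TwoShellChart

namespace Summit.AtomisticToContinuum.Crystallization.Theorems.NashClassCertificatesNashNearField

variable {ι : Type*} {cen : List IVec} {pos : ι → EuclideanSpace ℝ (Fin 3)} {i₀ : ι} {fC : IVec → ι}

/-! ### Symmetries -/

/-- The symmetries of the lists have signs `±1`. -/
theorem signs_of_mem_symList : ∀ (t : Bool), ∀ g ∈ symList t,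
    (g.2.1 = 1 ∨ g.2.1 = -1) ∧ (g.2.2.1 = 1 ∨ g.2.2.1 = -1) ∧ (g.2.2.2 = 1 ∨ g.2.2.2 = -1) := by
  decide

/-- `ivErase z l = some l'` means `l ~ z :: l'`. -/
theorem ivErase_perm {z : IVec} : ∀ {l l' : List IVec}, ivErase z l = some l' → List.Perm l (z :: l')
  | [], l', h => by simp [ivErase] at h
  | z' :: l, l', h => by
    unfold ivErase at h
    split_ifs at h with heq
    · simp only [Option.some.injEq] at h
      subst h
      have : z = z' := by
        obtain ⟨a, b, c⟩ := z; obtain ⟨a', b', c'⟩ := z'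
        simp only [veq, Bool.and_eq_true, beq_iff_eq] at heq
        rw [heq.1.1, heq.1.2, heq.2]
      rw [this]
    · cases h' : ivErase z l with
      | none => rw [h'] at h; simp at h
      | some l'' =>
        rw [h'] at h
        simp only [Option.map_some, Option.some.injEq] at h
        subst h
        exact ((ivErase_perm h').cons z').trans (List.Perm.swap z z' l'')

/-- **Soundness of `ivPerm`.** -/
theorem ivPerm_perm : ∀ {l m : List IVec}, ivPerm l m = true → List.Perm l m
  | [], [], _ => List.Perm.refl _
  | [], _ :: _, h => by simp [ivPerm] at h
  | z :: l, m, h => by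
    unfold ivPerm at h
    cases h' : ivErase z m with
    | none => rw [h'] at h; simp at h
    | some m' =>
      rw [h'] at h
      exact ((ivPerm_perm h).cons z).trans (ivErase_perm h').symm

/-- The symmetries of the lists permute the model lists (Boolean form). -/
theorem ivPerm_map_symApply : ∀ (t : Bool), ∀ g ∈ symList t,
    ivPerm ((modelList t).map (symApply g)) (modelList t) = true := by
  decide

/-- **The symmetries permute the patterns.** -/
theorem perm_map_symApply {t : Bool} {g : ℕ × IVec} (hg : g ∈ symList t) :
    List.Perm ((modelList t).map (symApply g)) (modelList t) :=
  ivPerm_perm (ivPerm_map_symApply t g hg)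

/-- `permApply` is injective. -/
theorem permApply_injective (k : ℕ) : Function.Injective (permApply k) := by
  intro z z' h
  obtain ⟨a, b, c⟩ := z; obtain ⟨a', b', c'⟩ := z'
  rcases Nat.lt_or_ge k 5 with hk | hk
  · interval_cases k <;> simp_all [permApply]
  · rw [permApply_of_ge k hk, permApply_of_ge k hk] at h
    simp_all

/-- A signed permutation with signs `±1` is injective on `ℤ³`. -/
theorem symApply_injective {g : ℕ × IVec} (h1 : g.2.1 = 1 ∨ g.2.1 = -1) (h2 : g.2.2.1 = 1 ∨ g.2.2.1 = -1)
    (h3 : g.2.2.2 = 1 ∨ g.2.2.2 = -1) : Function.Injective (symApply g) := by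
  intro z z' h
  apply permApply_injective g.1
  simp only [symApply, Prod.mk.injEq] at h
  obtain ⟨ha, hb, hc⟩ := h
  have s1 : g.2.1 ≠ 0 := by rcases h1 with h | h <;> omega
  have s2 : g.2.2.1 ≠ 0 := by rcases h2 with h | h <;> omega
  have s3 : g.2.2.2 ≠ 0 := by rcases h3 with h | h <;> omega
  refine Prod.ext (mul_left_cancel₀ s1 ha) (Prod.ext (mul_left_cancel₀ s2 hb) (mul_left_cancel₀ s3 hc))

/-- The witness composed with a symmetry: frame `B ∘ symLin g`, labels `fP ∘ symApply g`. -/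
theorem pivotGood_symm {j : ι} {W : PivotW ι} (hW : PivotGood pos j W) {g : ℕ × IVec} (hg : g ∈ symList W.t) :
    PivotGood pos j ⟨W.t, W.B ∘ₗ symLin g, W.ρ, fun w => W.fP (symApply g w)⟩ := by
  obtain ⟨hB, hρ1, hρ2, hpat, hinj, hcomp⟩ := hW
  obtain ⟨s1, s2, s3⟩ := signs_of_mem_symList W.t g hg
  have hperm := perm_map_symApply hg
  have hmem : ∀ w ∈ modelList W.t, symApply g w ∈ modelList W.t := fun w hw =>
    hperm.mem_iff.1 (List.mem_map_of_mem hw)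
  refine ⟨fun z => ?_, hρ1, hρ2, fun w hw => ?_, fun w hw w' hw' h => ?_, fun k hk hd => ?_⟩
  · simp only [LinearMap.coe_comp, Function.comp_apply]
    rw [hB, norm_symLin s1 s2 s3]
  · simp only [LinearMap.coe_comp, Function.comp_apply]
    rw [symLin_pt]
    exact hpat _ (hmem w hw)
  · exact symApply_injective s1 s2 s3 (hinj _ (hmem w hw) _ (hmem w' hw') h)
  · obtain ⟨w, hw, hfw⟩ := hcomp k hk hd
    obtain ⟨w₀, hw₀, rfl⟩ := List.mem_map.1 (hperm.mem_iff.2 hw)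
    exact ⟨w₀, hw₀, hfw⟩

/-- `phiEq` is equality of lists. -/
theorem phiEq_eq : ∀ {l m : List IVec}, phiEq l m = true → l = m
  | [], [], _ => rfl
  | [], _ :: _, h => by simp [phiEq] at h
  | _ :: _, [], h => by simp [phiEq] at h
  | a :: l, b :: m, h => by
    unfold phiEq at h
    rw [Bool.and_eq_true] at h
    obtain ⟨a1, a2, a3⟩ := a; obtain ⟨b1, b2, b3⟩ := b
    simp only [veq, Bool.and_eq_true, beq_iff_eq] at h
    rw [h.1.1.1, h.1.1.2, h.1.2, phiEq_eq h.2]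

/-- Labels transfer to the composed witness: if the actual labels are `phi₀.map (symApply g)` then `phi₀` are the labels
of the composed witness. -/
theorem labelsOK_symm {W : PivotW ι} {g : ℕ × IVec} (hg : g ∈ symList W.t) {cs phi₀ : List IVec}
    (hL : LabelsOK i₀ fC W cs (phi₀.map (symApply g))) :
    LabelsOK i₀ fC ⟨W.t, W.B ∘ₗ symLin g, W.ρ, fun w => W.fP (symApply g w)⟩ cs phi₀ := by
  obtain ⟨s1, s2, s3⟩ := signs_of_mem_symList W.t g hg
  have hperm := perm_map_symApply hg
  unfold LabelsOK at hL ⊢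
  rw [List.forall₂_map_right_iff] at hL
  refine hL.imp fun {c w} h => ⟨?_, h.2⟩
  -- `symApply g w ∈ modelList` and `g` injective ⇒ `w ∈ modelList`
  obtain ⟨u, hu, hgu⟩ := List.mem_map.1 (hperm.mem_iff.2 h.1)
  rwa [← symApply_injective s1 s2 s3 hgu]

/-! ### Orbits -/

/-- **Soundness of `checkOrbits`**: every candidate of the ordered commons is a symmetric image of a listed
representative. -/
theorem rep_of_checkOrbits {p : IVec} {cs : List IVec} {reps : List (Bool × List IVec)} {assign : List (ℕ × ℕ)}
    (h : checkOrbits cen p cs reps assign = true) {t : Bool} {phi : List IVec} (hc : (t, phi) ∈ candsOfCs cs) :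
    ∃ phi₀ g, (t, phi₀) ∈ reps ∧ g ∈ symList t ∧ phi = phi₀.map (symApply g) := by
  unfold checkOrbits at h
  simp only [Bool.and_eq_true, beq_iff_eq, List.all_eq_true] at h
  obtain ⟨⟨-, hlen⟩, hall⟩ := h
  obtain ⟨k, hk, hk2⟩ := List.mem_iff_getElem.1 hc
  have hk' : k < assign.length := by rw [← hlen]; exact hk
  have hzip : ((candsOfCs cs)[k], assign[k]) ∈ List.zip (candsOfCs cs) assign := by
    rw [List.mem_iff_getElem]
    exact ⟨k, by rw [List.length_zip]; exact lt_min hk hk', by rw [List.getElem_zip]⟩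
  have := hall _ hzip
  rw [hk2] at this
  simp only at this
  cases hr : reps[(assign[k]).1]? with
  | none => rw [hr] at this; simp at this
  | some r =>
    cases hg : (symList t)[(assign[k]).2]? with
    | none => rw [hr, hg] at this; simp at this
    | some g =>
      rw [hr, hg] at this
      simp only [Bool.and_eq_true, beq_iff_eq] at this
      obtain ⟨hrt, hphi⟩ := this
      refine ⟨r.2, g, ?_, List.mem_of_getElem? hg, phiEq_eq hphi⟩
      have : r = (t, r.2) := by rw [← hrt]
      rw [← this]
      exact List.mem_of_getElem? hr

/-- The commons list certified by `ivPerm` consists of commons and has no duplicates. -/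
theorem commons_of_ivPerm (hcen : cen.Nodup) (h0 : ((0 : ℤ), (0 : ℤ), (0 : ℤ)) ∉ cen) {p : IVec} {cs : List IVec}
    (h : ivPerm cs (commonsOf cen p) = true) : (∀ c ∈ cs, c ∈ commonsOf cen p) ∧ cs.Nodup := by
  have hperm := ivPerm_perm h
  refine ⟨fun c hc => hperm.mem_iff.1 hc, hperm.nodup_iff.2 ?_⟩
  unfold commonsOf
  exact List.Nodup.filter _ (List.nodup_cons.2 ⟨h0, hcen⟩)

/-- **Representative witnesses.**  For a good pivot and the data of the orbit certificate, there is a good witness (the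
original one composed with a symmetry) whose labels on the certified commons list form a listed representative. -/
theorem exists_rep_witness (hC : CentreGood cen pos i₀ fC) (hcen : cen.Nodup) (h0 : ((0 : ℤ), (0 : ℤ), (0 : ℤ)) ∉ cen)
    {p : IVec} (hp : p ∈ cen) {W : PivotW ι} (hW : PivotGood pos (fC p) W)
    {cs : List IVec} {reps : List (Bool × List IVec)} {assign : List (ℕ × ℕ)}
    (h : checkOrbits cen p cs reps assign = true) :
    ∃ g ∈ symList W.t, ∃ phi₀, (W.t, phi₀) ∈ reps ∧
      PivotGood pos (fC p) ⟨W.t, W.B ∘ₗ symLin g, W.ρ, fun w => W.fP (symApply g w)⟩ ∧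
      LabelsOK i₀ fC ⟨W.t, W.B ∘ₗ symLin g, W.ρ, fun w => W.fP (symApply g w)⟩ cs phi₀ := by
  have hiv : ivPerm cs (commonsOf cen p) = true := by
    unfold checkOrbits at h; simp only [Bool.and_eq_true] at h; exact h.1.1
  obtain ⟨hcs, hnd⟩ := commons_of_ivPerm hcen h0 hiv
  obtain ⟨phi, hL⟩ := exists_labelsOK hC hp hW cs hcs
  have hcand := mem_candsOfCs hC hp hW hcs hnd hL
  obtain ⟨phi₀, g, hrep, hg, rfl⟩ := rep_of_checkOrbits h hcand
  exact ⟨g, hg, phi₀, hrep, pivotGood_symm hW hg, labelsOK_symm hg hL⟩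

/-- **Registered sub-goal `stub_labelledPlacementIvPerm` of crux stmt-AtomisticToContinuum-16827** (landing anchor of this file,
re-exporting `ivPerm_perm`). -/
theorem stub_labelledPlacementIvPerm : ∀ (l m : List Literature.Geometry.DiscreteGeometry.TwoShellCheck.IVec), Literature.Geometry.DiscreteGeometry.TwoShellChart.ivPerm l m = true → List.Perm l m :=
  fun _ _ h => ivPerm_perm h

end Summit.AtomisticToContinuum.Crystallization.Theorems.NashClassCertificatesNashNearField

end
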